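import Summits.QuantumFields.BalabanUV.T4Continuum.Support.NE7K1LinSchurLineDerivRel

/-!
# NE7K1LinConjW — row NE7 (node U5), candidate route HOM, path H1L, cell K1-lin(s): the CONJUGATED MATRIX `conjW θ M = e^{θ}Me^{−θ}`
# and the ENERGY FORM of Combes–Thomas (kit for the weighted `∂_s` letter `NE7K1LinSchurLineDerivRelW`, (π6)'s item (i))

Lineage `b2b-balaban-t4-ne7-p2` (CRUX PROVER NE7 #2), generation 64.  [folklore], real matrices:
* §1 `conjW θ M = (e^{θ_j−θ_k}M_{jk})`: `conjW_add ∕ _smul ∕ _sub ∕ _mul ∕ _one ∕ _inv ∕ _transpose`; `conjW_mulVec_weight`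
  (`conjW θ M (e^{θ}g) = e^{θ}(Mg)`); `bilin_conjW_neg` ∕ `form_conjW_neg` (at `−θ` = at `θ` with arguments swapped, `M` symmetric);
  `form_conjW_sub_eq` (bridge to the tree's double-sum conjugation error); `wN_eq_dot` (`wN θ v = ‖e^{θ}v‖²`).
* §2 **THE ENERGY FORM OF COMBES–THOMAS** (lens 1 (π6) (i): «keep ⟨u,P(s)u⟩ instead of spending it on (σ∕2)‖u‖²»): if
  `σ‖w‖² ≤ ⟨w,Lw⟩` and the quadratic conjugation error of `L` at `θ` is `≥ −(σ∕2)‖w‖²`, then `conjW θ L` is invertible and for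
  `x = (conjW θ L)⁻¹v`: `‖x‖² ≤ 4‖v‖²∕σ²` AND `⟨x,Lx⟩ ≤ 4‖v‖²∕σ` (`coercive_conjW`, `energy_of_conj_inv`); `sqrt_le_of_sq_le`.

HONEST FRAMING: [folklore] finite real matrices; nothing printed asserted; no `sorry`.  FIXED FINITE T⁴, rung (B)+1; NE7 NOT PRINTED ∕
NOT PROVED; spine 0∕9; NOT infinite volume, NOT mass gap, NOT Clay.  HONEST DEPENDENCY: continuum YM on T⁴ ⇐ BetaPertH ∧ nine spine
estimates (0/9 proved); BetaPertH ⇐ (D1) ∧ (D4) ∧ CAP+tail; G-an2-4 gates asym, D1 and NE2/3/4.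
-/

noncomputable section

open Finset Matrix

namespace Summit.QuantumFields.BalabanUV.T4Continuum.NE7K1LinConjW

open NE7K1LinSchurLineForm NE7K1LinSchurLineDeriv NE7K1LinSchurLineDerivRel

variable {ι : Type*} [Fintype ι] [DecidableEq ι]

/-! ### §1 The conjugated matrix -/

/-- the conjugated matrix `(conjW θ M)_{jk} = e^{θ_j − θ_k}M_{jk}` (`= e^{θ}Me^{−θ}`). [folklore] -/
def conjW (θ : ι → ℝ) (M : Matrix ι ι ℝ) : Matrix ι ι ℝ := Matrix.of fun j k => Real.exp (θ j - θ k) * M j k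

omit [Fintype ι] [DecidableEq ι] in
/-- entries of `conjW`. [folklore] -/
theorem conjW_apply (θ : ι → ℝ) (M : Matrix ι ι ℝ) (j k : ι) : conjW θ M j k = Real.exp (θ j - θ k) * M j k := rfl

omit [Fintype ι] [DecidableEq ι] in
/-- `conjW` is additive. [folklore] -/
theorem conjW_add (θ : ι → ℝ) (M N : Matrix ι ι ℝ) : conjW θ (M + N) = conjW θ M + conjW θ N := by
  ext j k; simp only [conjW_apply, Matrix.add_apply]; ring

omit [Fintype ι] [DecidableEq ι] in
/-- `conjW` commutes with scalars. [folklore] -/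
theorem conjW_smul (θ : ι → ℝ) (c : ℝ) (M : Matrix ι ι ℝ) : conjW θ (c • M) = c • conjW θ M := by
  ext j k; simp only [conjW_apply, Matrix.smul_apply, smul_eq_mul]; ring

omit [Fintype ι] [DecidableEq ι] in
/-- `conjW` is subtractive. [folklore] -/
theorem conjW_sub (θ : ι → ℝ) (M N : Matrix ι ι ℝ) : conjW θ (M - N) = conjW θ M - conjW θ N := by
  ext j k; simp only [conjW_apply, Matrix.sub_apply]; ring

omit [Fintype ι] [DecidableEq ι] in
/-- transpose: `(conjW θ M)ᵀ = conjW (−θ) Mᵀ`. [folklore] -/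
theorem conjW_transpose (θ : ι → ℝ) (M : Matrix ι ι ℝ) : (conjW θ M)ᵀ = conjW (-θ) Mᵀ := by
  ext j k
  simp only [Matrix.transpose_apply, conjW_apply, Pi.neg_apply]
  congr 1
  congr 1
  ring

omit [DecidableEq ι] in
/-- `conjW θ M` applied to `e^{θ}g` is `e^{θ}(Mg)`. [folklore] -/
theorem conjW_mulVec_weight (θ : ι → ℝ) (M : Matrix ι ι ℝ) (g : ι → ℝ) :
    (conjW θ M).mulVec (fun k => Real.exp (θ k) * g k) = fun j => Real.exp (θ j) * M.mulVec g j := by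
  ext j
  simp only [mulVec, dotProduct, conjW_apply, Finset.mul_sum]
  refine Finset.sum_congr rfl fun k _ => ?_
  rw [Real.exp_sub]
  have hk : Real.exp (θ k) ≠ 0 := (Real.exp_pos _).ne'
  field_simp

omit [DecidableEq ι] in
/-- `conjW` is multiplicative. [folklore] -/
theorem conjW_mul (θ : ι → ℝ) (M N : Matrix ι ι ℝ) : conjW θ (M * N) = conjW θ M * conjW θ N := by
  ext j l
  simp only [conjW_apply, Matrix.mul_apply, Finset.mul_sum]
  refine Finset.sum_congr rfl fun k _ => ?_
  have : Real.exp (θ j - θ l) = Real.exp (θ j - θ k) * Real.exp (θ k - θ l) := by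
    rw [← Real.exp_add]; congr 1; ring
  rw [this]; ring

omit [Fintype ι] in
/-- `conjW θ 1 = 1`. [folklore] -/
theorem conjW_one (θ : ι → ℝ) : conjW θ (1 : Matrix ι ι ℝ) = 1 := by
  ext j k
  simp only [conjW_apply, Matrix.one_apply]
  by_cases h : j = k
  · subst h; simp
  · simp [h]

/-- `conjW` commutes with inversion (invertible `M`). [folklore] -/
theorem conjW_inv (θ : ι → ℝ) (M : Matrix ι ι ℝ) (hM : IsUnit M.det) : conjW θ M⁻¹ = (conjW θ M)⁻¹ := by
  symm
  exact Matrix.inv_eq_left_inv (by rw [← conjW_mul, nonsing_inv_mul _ hM, conjW_one])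

omit [DecidableEq ι] in
/-- the weighted squared norm `wN θ v` of `NE7K1LinSchurLineDeriv` is `‖e^{θ}v‖²`. [folklore] -/
theorem wN_eq_dot (θ v : ι → ℝ) : wN θ v = (fun i => Real.exp (θ i) * v i) ⬝ᵥ (fun i => Real.exp (θ i) * v i) := by
  simp only [wN, dotProduct, sq]

omit [DecidableEq ι] in
/-- the bilinear conjugation error at `−θ` is the one at `θ` with the arguments swapped (`M` symmetric). [folklore] -/
theorem bilin_conjW_neg (θ : ι → ℝ) (M : Matrix ι ι ℝ) (hM : M.IsSymm) (z u : ι → ℝ) :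
    z ⬝ᵥ (conjW (-θ) M).mulVec u = u ⬝ᵥ (conjW θ M).mulVec z := by
  have h : conjW (-θ) M = (conjW θ M)ᵀ := by rw [conjW_transpose, hM.eq]
  rw [h, mulVec_transpose, dotProduct_comm, ← dotProduct_mulVec]

omit [DecidableEq ι] in
/-- the quadratic form of `conjW (−θ) M` equals that of `conjW θ M` (`M` symmetric). [folklore] -/
theorem form_conjW_neg (θ : ι → ℝ) (M : Matrix ι ι ℝ) (hM : M.IsSymm) (w : ι → ℝ) :
    w ⬝ᵥ (conjW (-θ) M).mulVec w = w ⬝ᵥ (conjW θ M).mulVec w := bilin_conjW_neg θ M hM w w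

omit [DecidableEq ι] in
/-- the quadratic conjugation error of `conjW` is the tree's double sum (bridge to `NE7K1LinFineOpWeight.conjError_fineOpR_ge` and
`NE7K1LinSchurLineForm.conjError_eq`). [folklore] -/
theorem form_conjW_sub_eq (θ : ι → ℝ) (M : Matrix ι ι ℝ) (w : ι → ℝ) :
    w ⬝ᵥ (conjW θ M).mulVec w - w ⬝ᵥ M.mulVec w = ∑ j, ∑ k, (Real.exp (θ j - θ k) - 1) * M j k * (w j * w k) := by
  simp only [dotProduct, mulVec, conjW_apply, Finset.mul_sum, ← Finset.sum_sub_distrib]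
  exact Finset.sum_congr rfl fun j _ => Finset.sum_congr rfl fun k _ => by ring

/-! ### §2 The energy form of Combes–Thomas -/

omit [DecidableEq ι] in
/-- the conjugated operator inherits half the floor: `σ‖w‖² ≤ ⟨w,Lw⟩` and quadratic error `≥ −(σ∕2)‖w‖²` ⇒
`(σ∕2)‖w‖² ≤ ⟨w,(conjW θ L)w⟩` AND `½⟨w,Lw⟩ ≤ ⟨w,(conjW θ L)w⟩`. [folklore] -/
theorem coercive_conjW (θ : ι → ℝ) (L : Matrix ι ι ℝ) {σ : ℝ} (hL : ∀ w, σ * (w ⬝ᵥ w) ≤ w ⬝ᵥ L.mulVec w)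
    (herr : ∀ w, -(σ / 2) * (w ⬝ᵥ w) ≤ w ⬝ᵥ (conjW θ L).mulVec w - w ⬝ᵥ L.mulVec w) (w : ι → ℝ) :
    σ / 2 * (w ⬝ᵥ w) ≤ w ⬝ᵥ (conjW θ L).mulVec w ∧ (w ⬝ᵥ L.mulVec w) / 2 ≤ w ⬝ᵥ (conjW θ L).mulVec w := by
  have h1 := hL w
  have h2 := herr w
  constructor <;> linarith

/-- **THE ENERGY FORM OF COMBES–THOMAS**: for `x = (conjW θ L)⁻¹v` (under the hypotheses of `coercive_conjW`, `σ > 0`):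
`‖x‖² ≤ 4‖v‖²∕σ²` and `⟨x,Lx⟩ ≤ 4‖v‖²∕σ`. [folklore] -/
theorem energy_of_conj_inv (θ : ι → ℝ) (L : Matrix ι ι ℝ) {σ : ℝ} (hσ : 0 < σ)
    (hL : ∀ w, σ * (w ⬝ᵥ w) ≤ w ⬝ᵥ L.mulVec w)
    (herr : ∀ w, -(σ / 2) * (w ⬝ᵥ w) ≤ w ⬝ᵥ (conjW θ L).mulVec w - w ⬝ᵥ L.mulVec w) (v : ι → ℝ) :
    IsUnit (conjW θ L).det ∧
      ((conjW θ L)⁻¹.mulVec v ⬝ᵥ (conjW θ L)⁻¹.mulVec v ≤ 4 * (v ⬝ᵥ v) / σ ^ 2 ∧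
        (conjW θ L)⁻¹.mulVec v ⬝ᵥ L.mulVec ((conjW θ L)⁻¹.mulVec v) ≤ 4 * (v ⬝ᵥ v) / σ) := by
  have hco : ∀ w, σ / 2 * (w ⬝ᵥ w) ≤ w ⬝ᵥ (conjW θ L).mulVec w := fun w => (coercive_conjW θ L hL herr w).1
  have hdet : IsUnit (conjW θ L).det := isUnit_det_of_coercive _ (by linarith) hco
  set x := (conjW θ L)⁻¹.mulVec v with hx
  have hsolve : (conjW θ L).mulVec x = v := by rw [hx, mulVec_mulVec, mul_nonsing_inv _ hdet, one_mulVec]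
  have hpair : σ / 2 * (x ⬝ᵥ x) ≤ x ⬝ᵥ v := by rw [← hsolve]; exact hco x
  have h := dot_le_of_coercive_pair (σ := σ / 2) (by linarith) x v hpair
  have hvv : 0 ≤ v ⬝ᵥ v := by
    simp only [dotProduct]; exact Finset.sum_nonneg fun _ _ => mul_self_nonneg _
  refine ⟨hdet, ?_, ?_⟩
  · calc x ⬝ᵥ x ≤ (v ⬝ᵥ v) / (σ / 2) ^ 2 := h.2
      _ = 4 * (v ⬝ᵥ v) / σ ^ 2 := by field_simp; ring
  · have he := (coercive_conjW θ L hL herr x).2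
    rw [hsolve] at he
    calc x ⬝ᵥ L.mulVec x ≤ 2 * (x ⬝ᵥ v) := by linarith
      _ ≤ 2 * ((v ⬝ᵥ v) / (σ / 2)) := by linarith [h.1]
      _ = 4 * (v ⬝ᵥ v) / σ := by field_simp; ring

omit [Fintype ι] [DecidableEq ι] in
/-- `√(a·A²) = √a·A` for `a, A ≥ 0` (helper). [folklore] -/
theorem sqrt_le_of_sq_le {X a A : ℝ} (ha : 0 ≤ a) (hA : 0 ≤ A) (h : X ≤ a * A ^ 2) :
    Real.sqrt X ≤ Real.sqrt a * A := by
  calc Real.sqrt X ≤ Real.sqrt (a * A ^ 2) := Real.sqrt_le_sqrt h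
    _ = Real.sqrt a * A := by rw [Real.sqrt_mul ha, Real.sqrt_sq hA]

end Summit.QuantumFields.BalabanUV.T4Continuum.NE7K1LinConjW
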